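import Summits.QuantumFields.YangMills.Theorems.BalabanUVNodesN19MGFFormAtRecord
import Literature.MathematicalPhysics.QuantumFieldTheory.Balaban1983to89.Node00.RStepProvisosIntOfRecord
import Literature.MathematicalPhysics.QuantumFieldTheory.Balaban1983to89.Node00.Record13CoPH

/-!
# BalabanUVNodes ∕ N19 (NE7) — E1 AT EVERY LEVEL FOR NODE 00's DRESSED SLOT FAMILY: the [IV] (0.4) ∕ [III] (3.25) MASS IDENTITY
# `∫ dressedDensityOfDatum₉ ϑ D g₀ os t p g (k+1) dV_{k+1} = ∫ dressedDensityOfDatum₉ ϑ D g₀ os t p g k dV_k` (`k < K`) AT AN IDENTITY-SELECTOR TUPLE, hence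
# `∫ dressedDensityOfDatum₉ … k = schemeZ (D.scheme g₀) os K t` and ★ `Σ_s classWeightOfDatum₉ ϑ D g₀ os p g k t s = schemeZ (D.scheme g₀) os K t` for EVERY `k ≤ K`
# — module B′ of the N19 MGF road (module B = `…N19MGFFormAtRecord`, p494399 ∕ p497235)

Cell `pub-ymgap` (HUMAN RULING D-0062, Track A), R134 seat `pub-ymgap-dag-n19-d` (gen 9), lens decomp v5 ROW MF-ID ∕ dag-lead REBALANCE №65 (c) «AT-RECORD seat of the
MGF road»; dag-lead g11 LANE WORD (bus l.21525, 2026-08-27 16:44Z): «the (e2) MASS IDENTITY at the record for F3's dressed family is YOURS».  Filed `--kind proof --supports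
stmt-QuantumFields-20544 --as helper` (K3⁷ `SpineGivenEndpointR13SepCoPH`, dag-lead WORDS-143); COUNT-NEUTRAL.  [III] = [Balaban1988Convergent], [IV] = [Balaban1989LargeFieldI].

WHY.  F3 (`Node00/DressedSlotsOfRecord.lean`, dag-n20-e; re-keyed at Stage 9 ∕ 12 ∕ 13 by dag-n20-d) typed the DRESSED (2.18) family `dressedSlotsOfDatum₉` — def-T's slot
recursion started at the dressed start `e^{t·F}·e^{−A∕g₀(K)²}` of a datum's Wilson scheme — and proved E1 («the class weights sum to the scheme's dressed partition function»)
AT LEVEL 0 ONLY (`integral_dressedDensityOfDatum₉_zero`, `sum_classWeightOfDatum₉_zero`), locating the rest: «E1 BEYOND LEVEL 0 is NOT proved here; it needs (e1)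
INTEGRABILITY of the dressed pieces and (e2) the (0.4) telescoping `∫ dressedDensity_{k+1} = ∫ dressedDensity_k` of def-T's T-step and def-R's R-step ON THE DRESSED
FAMILY».  Module A2 ∕ B of this seat (g6) discharged (e1) at the identity selector (`integrable_chi_mul_texpAOfRecordFrom`, `sum_classWeightOfDatum₉_eq_integral_of_ppSelId`).
THIS FILE discharges (e2) at the identity selector and assembles E1 AT EVERY LEVEL `k ≤ K` — one displayed hypothesis of every spine-carrier reading built on F3's class
weights (the `schemeZ … (K₀+K) t = Σ_{τ ∈ T K} A K t τ` conjunct of the keyed extraction clause `hx` of this seat's K3 faces, e.g. `…N19TargetK3R13SepCoPHReading` §2)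
becomes a theorem at such tuples.

HOW (a composition of PROVED tree lemmas; no estimate).  Level `k+1` of the dressed family is def-R's R-step OF RECORD at `ϑ.ppSel` applied to def-T's T-step (†) of
level `k` (`texpAOfRecordFrom_succ`, `rfl`).  (R) At a selector that is the identity at level `k+1`, def-R's **`integral_densityOfSlice_rstepSlotOfRecord_of_sel_id`**
([IV] (0.4) from integrability and a.e. signs ALONE — b01's fibre lemma) equates the integral of the R-stepped slice density with that of the pre-𝐑 one; its
inputs — integrability and non-negativity of the PRE-𝐑 dressed slots — come from def-T's `integrable_piece_texpASucc` (front factor `≡ 1`; `avOfRecord_haarAC`, `k < K`)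
over module B's (e1) at level `k`, and from n23-b's `tstepOfRecord_nonneg` over dag-n19-c's `dressedSlotsOfDatum₉_nonneg`.  (T) def-T's **`isRT_tstepOfRecord`** — the
T-step of record IS a renormalization transformation under the DISPLAYED unity law of the step weights (`isStepUnity_wOfRecord` ⟸ `IsZetaUnity`, the record's row
`zetaUnity`), `|w| ≤ 1`, measurability, `HaarAC` — gives `∫ Σ_{s'} χ_{k+1}(s')·(𝐓 slot_k)(s') dV_{k+1} = ∫ Σ_s χ_k(s)·slot_k(s) dV_k` (`T4Spectator.integral_eq_of_isRT`).
Induction on `k` from F3's level-0 identity, then module B's (e1) sum ∕ integral exchange.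

WHAT IS PROVED (all at a Stage-9 tuple `ϑ`; `K = p.K`).
* §1 IDENTITY SELECTOR `ϑ.ppSel = ppSelIdOfRecord`, displayed laws `0 ≤ wOfRecord₉ ϑ ≤ 1` (jointly measurable), measurable `χ_k`, `IsZetaUnity ϑ.ζ`, `D.AvgMeasurable`:
  `integrable_tstep_dressedSlotsOfDatum₉_of_ppSelId` · `tstep_dressedSlotsOfDatum₉_nonneg` · ★ `integral_dressedDensityOfDatum₉_succ_of_ppSelId` ((e2), `k < K`) ·
  ★ `integral_dressedDensityOfDatum₉_eq_schemeZ_of_ppSelId` (`k ≤ K`) · ★★ `sum_classWeightOfDatum₉_eq_schemeZ_of_ppSelId` (E1 at every level `k ≤ K`).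
* §2 THE LAWS DISCHARGED from NODE 00's rows as in module B §3: `0 ≤ w ≤ 1` from `0 ≤ ζ` + `IsZetaAbsLeOne`, measurability from (H-U) `LocalBgMeasurable` + (H-ζ)
  `ZetaMeasurable` (`Record12Measurability`): `sum_classWeightOfDatum₉_eq_schemeZ_of_localBg`.
* §3 AT THE LIVE SELECTOR OF RECORD `ϑ.ppSel = ppSelLiveOfRecord … E (wOfRecord₉ ϑ)` (the K0 witnesses' selector), for `g 0 = g₀ K`: by ONE rewrite along dag-n19-c's
  tower identity `classWeightOfDatum₉_ppSelLive_eq_ppSelId`: ★ `sum_classWeightOfDatum₉_eq_schemeZ_of_ppSelLive` (+ `_of_ppSelLive_of_localBg`).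

HONEST FRAMING — what this is NOT.  [folklore ∕ bookkeeping]: a finite-sum ∕ Fubini ∕ disintegration identity on NODE 00's typed objects under DISPLAYED laws (the
record's ζ-rows, (H-U)∕(H-ζ) measurability, `0 ≤ ζ`); it proves NO estimate (NE7 ∕ NE7b ∕ NE7c NOT PRINTED for d = 4, NOT proved; (V)+(I), `TiltedMeanMatching`
untouched); it does NOT build the Summits-side spine-carrier reading `cr`; it is NOT valid at a contentful selector (lens ROW K14-β); nothing of Bałaban's is asserted
or instantiated; no `Provisos₁₃CoPH` inhabitant claimed (K0⁷ open); N19 NOT discharged (0∕1); K3⁷ NOT claimed; counts UNMOVED (typed 28∕28 · discharged 5∕27, A 5∕28).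
One finite four-torus programme at fixed `ε` — NOT ℝ⁴, NOT infinite volume, NOT OS, NOT a mass gap, NOT the Clay problem.  No `sorry`, no `axiom`, no `instance`,
no `notation`, no `def` (theorems only).
-/

noncomputable section

namespace Summit.QuantumFields.YangMills.BalabanUVNodes.N19MGFFormAtRecordMass

open MeasureTheory
open scoped BigOperators ENNReal Matrix.Norms.L2Operator
open Literature.MathematicalPhysics.QuantumFieldTheory.Balaban1983to89
open Literature.MathematicalPhysics.QuantumFieldTheory.Balaban1983to89.Node00
open T4Continuum B14.Eq218Concrete
open Summit.QuantumFields.YangMills.BalabanUVNodes.N19MGFFormAtRecord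
open Summit.QuantumFields.YangMills.BalabanUVNodes.N19MGFRoadLiveSelectorTower (dressedSlotsOfDatum₉_nonneg classWeightOfDatum₉_ppSelLive_eq_ppSelId)

variable {F : T4Family} {N : ℕ} [NeZero N]

/-! ## §1 At an identity-selector Stage-9 tuple: the pre-𝐑 dressed slots, (e2) the one-step mass identity, E1 at every level -/

section IdentitySelector

variable (ϑ : Stage9Params F N) {p : B12.RunParams} {g : ℕ → ℝ}

/-- **THE PRE-𝐑 DRESSED SLOTS ARE INTEGRABLE** (`k < K`): def-T's T-step (†) of the level-`k` dressed slots, sequence by sequence, over the level-`(k+1)` field measure —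
def-T's `integrable_piece_texpASucc` with front factor `≡ 1`, fed by module B's (e1) `integrable_chi_mul_dressedSlotsOfDatum₉_of_ppSelId` at level `k` (identity selector,
displayed laws) and the tree's `avOfRecord_haarAC`. [cite: Balaban1988Convergent, (3.1) p.264, (3.24)–(3.25) p.270 (bookkeeping)] -/
theorem integrable_tstep_dressedSlotsOfDatum₉_of_ppSelId (hsel : ϑ.ppSel = ppSelIdOfRecord F ϑ.ν ϑ.τ9.M)
    (hw0 : ∀ k s' U V', 0 ≤ wOfRecord₉ F N ϑ p g k s' U V') (hw1 : ∀ k s' U V', wOfRecord₉ F N ϑ p g k s' U V' ≤ 1)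
    (hwm : ∀ k s', Measurable fun z : GaugeField (F.P p.K) (k + 1) (SU N) × GaugeField (F.P p.K) k (SU N) => wOfRecord₉ F N ϑ p g k s' z.2 z.1)
    (hχm : ∀ k s, Measurable (chiSeqOfRecord F N ϑ.ν ϑ.τ9.M g p.K k s)) (D : FiniteEpsData F (SU N)) (hD : D.AvgMeasurable)
    (g₀ : ℕ → ℝ) (os : List (ULoop F)) (t : ℝ) (k : ℕ) (hk : k < p.K) (s' : SeqOfRecord F ϑ.ν ϑ.τ9.M g p.K (k + 1)) :
    Integrable (tstepOfRecord F N ϑ.ν ϑ.τ9.M (wOfRecord₉ F N ϑ) p g k (dressedSlotsOfDatum₉ F N ϑ D g₀ os t p g k) s')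
      (fieldMeasure (F.P p.K) (k + 1) (SU N)) := by
  have hwb : ∀ U V', |wOfRecord₉ F N ϑ p g k s' U V'| ≤ 1 := fun U V' => by
    rw [abs_of_nonneg (hw0 k s' U V')]
    exact hw1 k s' U V'
  have h := integrable_piece_texpASucc (avOfRecord_measurable F N p.K k) (avOfRecord_haarAC F N p.K k hk)
    (chiSeqOfRecord F N ϑ.ν ϑ.τ9.M g p.K k) (dressedSlotsOfDatum₉ F N ϑ D g₀ os t p g k)
    (fun (_ : SeqOfRecord F ϑ.ν ϑ.τ9.M g p.K (k + 1)) (_ : GaugeField (F.P p.K) (k + 1) (SU N)) => (1 : ℝ))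
    (wOfRecord₉ F N ϑ p g k) s'
    (integrable_chi_mul_dressedSlotsOfDatum₉_of_ppSelId ϑ hsel hw0 hw1 hwm hχm D hD g₀ os t k s'.init) (hwm k s') hwb measurable_const
    (fun _ => by rw [abs_one])
  refine h.congr (ae_of_all _ fun V' => ?_)
  show (1 : ℝ) * _ = _
  rw [one_mul]
  rfl

/-- **THE PRE-𝐑 DRESSED SLOTS ARE NON-NEGATIVE** (pointwise; ANY selector): n23-b's `tstepOfRecord_nonneg` over dag-n19-c's `dressedSlotsOfDatum₉_nonneg` (dressed start `> 0`,
`0 ≤ w`, `0 ≤ χ`). [cite: Balaban1988Convergent, (3.1) p.264, (3.24) p.270 (bookkeeping)] -/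
theorem tstep_dressedSlotsOfDatum₉_nonneg (hw0 : ∀ k s' U V', 0 ≤ wOfRecord₉ F N ϑ p g k s' U V') (D : FiniteEpsData F (SU N)) (g₀ : ℕ → ℝ)
    (os : List (ULoop F)) (t : ℝ) (k : ℕ) (s' : SeqOfRecord F ϑ.ν ϑ.τ9.M g p.K (k + 1)) (V' : GaugeField (F.P p.K) (k + 1) (SU N)) :
    0 ≤ tstepOfRecord F N ϑ.ν ϑ.τ9.M (wOfRecord₉ F N ϑ) p g k (dressedSlotsOfDatum₉ F N ϑ D g₀ os t p g k) s' V' :=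
  tstepOfRecord_nonneg F N ϑ.ν ϑ.τ9.M (hw0 k) (fun s U => dressedSlotsOfDatum₉_nonneg F N ϑ D g₀ os p g hw0 t k s U) s' V'

/-- **★ (e2) — THE ONE-STEP MASS IDENTITY FOR THE DRESSED FAMILY, IDENTITY SELECTOR** (`k < K`): `∫ dressedDensity_{k+1} dV_{k+1} = ∫ dressedDensity_k dV_k`.  Level `k+1`
is def-R's R-step of record (identity at level `k+1`) of def-T's T-step of level `k` (`rfl`); def-R's `integral_densityOfSlice_rstepSlotOfRecord_of_sel_id` ((0.4) from
integrability + a.e. signs of the pre-𝐑 slots) followed by def-T's `isRT_tstepOfRecord` at `f ≡ 1` (unity law from `IsZetaUnity`, `|w| ≤ 1`, measurability, `HaarAC`).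
[cite: Balaban1989LargeFieldI, (0.4) p.176; Balaban1988Convergent, (3.25) p.270; Balaban1985UV3, (6) p.257] -/
theorem integral_dressedDensityOfDatum₉_succ_of_ppSelId (hsel : ϑ.ppSel = ppSelIdOfRecord F ϑ.ν ϑ.τ9.M)
    (hw0 : ∀ k s' U V', 0 ≤ wOfRecord₉ F N ϑ p g k s' U V') (hw1 : ∀ k s' U V', wOfRecord₉ F N ϑ p g k s' U V' ≤ 1)
    (hwm : ∀ k s', Measurable fun z : GaugeField (F.P p.K) (k + 1) (SU N) × GaugeField (F.P p.K) k (SU N) => wOfRecord₉ F N ϑ p g k s' z.2 z.1)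
    (hχm : ∀ k s, Measurable (chiSeqOfRecord F N ϑ.ν ϑ.τ9.M g p.K k s)) (hζu : IsZetaUnity F N ϑ.ν ϑ.τ9.M ϑ.ζ)
    (D : FiniteEpsData F (SU N)) (hD : D.AvgMeasurable) (g₀ : ℕ → ℝ) (os : List (ULoop F)) (t : ℝ) (k : ℕ) (hk : k < p.K) :
    ∫ V, dressedDensityOfDatum₉ F N ϑ D g₀ os t p g (k + 1) V ∂fieldMeasure (F.P p.K) (k + 1) (SU N)
      = ∫ U, dressedDensityOfDatum₉ F N ϑ D g₀ os t p g k U ∂fieldMeasure (F.P p.K) k (SU N) := by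
  classical
  have hsel' : ∀ s : SeqOfRecord F ϑ.ν ϑ.τ9.M g p.K (k + 1), ϑ.ppSel p g (k + 1) s = s := fun s => by
    rw [hsel]
    rfl
  have hwb : ∀ s' U V', |wOfRecord₉ F N ϑ p g k s' U V'| ≤ 1 := fun s' U V' => by
    rw [abs_of_nonneg (hw0 k s' U V')]
    exact hw1 k s' U V'
  -- the PRE-𝐑 dressed family (level 0 = the start; level i+1 = the T-step of the dressed level i), packaged as a slot family of record
  let preR : TexpAOfRecord F N ϑ.ν ϑ.τ9.M := fun p' g' j =>
    Nat.rec (motive := fun j => SeqOfRecord F ϑ.ν ϑ.τ9.M g' p'.K j → Density (F.P p'.K) j (SU N))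
      (dressedSlotsOfDatum₉ F N ϑ D g₀ os t p' g' 0)
      (fun i _ => tstepOfRecord F N ϑ.ν ϑ.τ9.M (wOfRecord₉ F N ϑ) p' g' i (dressedSlotsOfDatum₉ F N ϑ D g₀ os t p' g' i)) j
  have hpre : preR p g (k + 1) = tstepOfRecord F N ϑ.ν ϑ.τ9.M (wOfRecord₉ F N ϑ) p g k (dressedSlotsOfDatum₉ F N ϑ D g₀ os t p g k) := rfl
  -- (R) def-R's (0.4) at the identity selector, from integrability and signs of the pre-𝐑 slots
  have hR := integral_densityOfSlice_rstepSlotOfRecord_of_sel_id F N ϑ.ν ϑ.τ9 preR ϑ.ppSel p g (k + 1) hsel'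
    (fun s => (hχm (k + 1) s).aestronglyMeasurable)
    (fun s' => by
      rw [hpre]
      exact integrable_tstep_dressedSlotsOfDatum₉_of_ppSelId ϑ hsel hw0 hw1 hwm hχm D hD g₀ os t k hk s')
    (fun s' => ae_of_all _ fun V' => by
      rw [hpre]
      exact tstep_dressedSlotsOfDatum₉_nonneg ϑ hw0 D g₀ os t k s' V')
  -- (T) def-T's T-step of record is an RT (unity law of the step weights of record from `IsZetaUnity`)
  have hT := T4Spectator.integral_eq_of_isRT
    (isRT_tstepOfRecord F N ϑ.ν ϑ.τ9.M (wOfRecord₉ F N ϑ) p g k hk (dressedSlotsOfDatum₉ F N ϑ D g₀ os t p g k)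
      (fun s => integrable_chi_mul_dressedSlotsOfDatum₉_of_ppSelId ϑ hsel hw0 hw1 hwm hχm D hD g₀ os t k s) (hwm k) hwb (hχm (k + 1))
      (isStepUnity_wOfRecord F N ϑ.ν ϑ.τ9.M ϑ.A₁ hζu p g k))
  -- assemble: level k+1 IS the R-stepped slice of the pre-𝐑 family (`rfl`); the pre-𝐑 slice density IS `Σ χ_{k+1}·(𝐓 slot_k)` (`rfl`)
  have e1 : (fun V => dressedDensityOfDatum₉ F N ϑ D g₀ os t p g (k + 1) V)
      = densityOfSlice F N ϑ.ν ϑ.τ9.M p g (k + 1) (rstepSlotOfRecord F N ϑ.ν ϑ.τ9 ϑ.ppSel p g (k + 1) (preR p g (k + 1))) := rfl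
  have e2 : densityOfRepr F N ϑ.ν ϑ.τ9.M preR p g (k + 1)
      = fun V' => ∑ s', chiSeqOfRecord F N ϑ.ν ϑ.τ9.M g p.K (k + 1) s' V' *
          tstepOfRecord F N ϑ.ν ϑ.τ9.M (wOfRecord₉ F N ϑ) p g k (dressedSlotsOfDatum₉ F N ϑ D g₀ os t p g k) s' V' := rfl
  have e3 : (fun U => dressedDensityOfDatum₉ F N ϑ D g₀ os t p g k U)
      = fun U => ∑ s, chiSeqOfRecord F N ϑ.ν ϑ.τ9.M g p.K k s U * dressedSlotsOfDatum₉ F N ϑ D g₀ os t p g k s U := rfl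
  rw [e1, hR, e2, e3]
  exact hT

/-- **★ THE DRESSED DENSITY INTEGRATES TO THE SCHEME'S DRESSED PARTITION FUNCTION AT EVERY LEVEL `k ≤ K`** (identity selector; displayed laws): induction on `k` from
F3's `integral_dressedDensityOfDatum₉_zero` (E1 at level 0, `rfl`-grade) through (e2). [cite: Balaban1985UV3, (6) p.257; King1986, (3.10) p.656; Balaban1989LargeFieldI, (0.4) p.176] -/
theorem integral_dressedDensityOfDatum₉_eq_schemeZ_of_ppSelId (hsel : ϑ.ppSel = ppSelIdOfRecord F ϑ.ν ϑ.τ9.M)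
    (hw0 : ∀ k s' U V', 0 ≤ wOfRecord₉ F N ϑ p g k s' U V') (hw1 : ∀ k s' U V', wOfRecord₉ F N ϑ p g k s' U V' ≤ 1)
    (hwm : ∀ k s', Measurable fun z : GaugeField (F.P p.K) (k + 1) (SU N) × GaugeField (F.P p.K) k (SU N) => wOfRecord₉ F N ϑ p g k s' z.2 z.1)
    (hχm : ∀ k s, Measurable (chiSeqOfRecord F N ϑ.ν ϑ.τ9.M g p.K k s)) (hζu : IsZetaUnity F N ϑ.ν ϑ.τ9.M ϑ.ζ)
    (D : FiniteEpsData F (SU N)) (hD : D.AvgMeasurable) (g₀ : ℕ → ℝ) (os : List (ULoop F)) (t : ℝ) :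
    ∀ (k : ℕ), k ≤ p.K →
      ∫ V, dressedDensityOfDatum₉ F N ϑ D g₀ os t p g k V ∂fieldMeasure (F.P p.K) k (SU N) = T4GenFunBounds.schemeZ (D.scheme g₀) os p.K t
  | 0, _ => integral_dressedDensityOfDatum₉_zero F N ϑ D g₀ os t p g
  | k + 1, hk => by
      rw [integral_dressedDensityOfDatum₉_succ_of_ppSelId ϑ hsel hw0 hw1 hwm hχm hζu D hD g₀ os t k (Nat.lt_of_succ_le hk)]
      exact integral_dressedDensityOfDatum₉_eq_schemeZ_of_ppSelId hsel hw0 hw1 hwm hχm hζu D hD g₀ os t k (Nat.le_of_succ_le hk)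

/-- **★★ E1 AT EVERY LEVEL — THE CLASS WEIGHTS OF LEVEL `k ≤ K` SUM TO THE SCHEME'S DRESSED PARTITION FUNCTION** (identity selector; displayed laws):
`Σ_s classWeightOfDatum₉ ϑ D g₀ os p g k t s = schemeZ (D.scheme g₀) os K t` — module B's (e1) sum ∕ integral exchange, then the previous face.  F3's
`sum_classWeightOfDatum₉_zero` is the case `k = 0`. [cite: Balaban1985UV3, (6) p.257; King1986, (3.10) p.656; Balaban1988Convergent, (2.18) p.257] -/
theorem sum_classWeightOfDatum₉_eq_schemeZ_of_ppSelId (hsel : ϑ.ppSel = ppSelIdOfRecord F ϑ.ν ϑ.τ9.M)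
    (hw0 : ∀ k s' U V', 0 ≤ wOfRecord₉ F N ϑ p g k s' U V') (hw1 : ∀ k s' U V', wOfRecord₉ F N ϑ p g k s' U V' ≤ 1)
    (hwm : ∀ k s', Measurable fun z : GaugeField (F.P p.K) (k + 1) (SU N) × GaugeField (F.P p.K) k (SU N) => wOfRecord₉ F N ϑ p g k s' z.2 z.1)
    (hχm : ∀ k s, Measurable (chiSeqOfRecord F N ϑ.ν ϑ.τ9.M g p.K k s)) (hζu : IsZetaUnity F N ϑ.ν ϑ.τ9.M ϑ.ζ)
    (D : FiniteEpsData F (SU N)) (hD : D.AvgMeasurable) (g₀ : ℕ → ℝ) (os : List (ULoop F)) (t : ℝ) (k : ℕ) (hk : k ≤ p.K) :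
    ∑ s : SeqOfRecord F ϑ.ν ϑ.τ9.M g p.K k, classWeightOfDatum₉ F N ϑ D g₀ os p g k t s = T4GenFunBounds.schemeZ (D.scheme g₀) os p.K t := by
  rw [sum_classWeightOfDatum₉_eq_integral_of_ppSelId ϑ hsel hw0 hw1 hwm hχm D hD g₀ os t k]
  exact integral_dressedDensityOfDatum₉_eq_schemeZ_of_ppSelId ϑ hsel hw0 hw1 hwm hχm hζu D hD g₀ os t k hk

end IdentitySelector

/-! ## §2 The displayed laws discharged from NODE 00's rows: `0 ≤ w ≤ 1` from `0 ≤ ζ` ∕ `IsZetaAbsLeOne`, measurability from (H-U) ∕ (H-ζ) (module B §3's dictionary) -/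

section Laws

variable (ϑ : Stage9Params F N) {p : B12.RunParams} {g : ℕ → ℝ}

/-- **★ E1 AT EVERY LEVEL, LAWS FROM THE ROWS** (identity selector): local backgrounds measurable ((H-U) `LocalBgMeasurable`), the residual `ζ` jointly measurable ((H-ζ)),
`0 ≤ ζ`, `IsZetaAbsLeOne ζ`, `IsZetaUnity ζ` (the record's rows `zetaAbs` ∕ `zetaUnity`), `D.AvgMeasurable` ⇒ `Σ_s classWeightOfDatum₉ ϑ D g₀ os p g k t s = schemeZ (D.scheme g₀) os K t`
for every `k ≤ K`. [cite: Balaban1985UV3, (6) p.257; King1986, (3.10) p.656; Balaban1988Convergent, (3.16) p.268, (3.20)–(3.21) p.269 (bookkeeping)] -/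
theorem sum_classWeightOfDatum₉_eq_schemeZ_of_localBg (hsel : ϑ.ppSel = ppSelIdOfRecord F ϑ.ν ϑ.τ9.M)
    (hU : LocalBgMeasurable F N ϑ.ν) (hζm : ZetaMeasurable F N ϑ.ζ) (hζ0 : ∀ p g k s Pl Ql RS U V', 0 ≤ ϑ.ζ p g k s Pl Ql RS U V')
    (hζ1 : IsZetaAbsLeOne F N ϑ.ν ϑ.τ9.M ϑ.ζ) (hζu : IsZetaUnity F N ϑ.ν ϑ.τ9.M ϑ.ζ)
    (D : FiniteEpsData F (SU N)) (hD : D.AvgMeasurable) (g₀ : ℕ → ℝ) (os : List (ULoop F)) (t : ℝ) (k : ℕ) (hk : k ≤ p.K) :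
    ∑ s : SeqOfRecord F ϑ.ν ϑ.τ9.M g p.K k, classWeightOfDatum₉ F N ϑ D g₀ os p g k t s = T4GenFunBounds.schemeZ (D.scheme g₀) os p.K t :=
  sum_classWeightOfDatum₉_eq_schemeZ_of_ppSelId ϑ hsel (wOfRecord₉_nonneg ϑ hζ0 p g) (wOfRecord₉_le_one ϑ hζ1 p g)
    (fun k s' => measurable_wOfRecord_of_localBg hU ϑ.τ9.M ϑ.A₁ hζm p g k s')
    (fun k s => measurable_chiSeqOfRecord_of_localBg hU ϑ.τ9.M g p.K k s) hζu D hD g₀ os t k hk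

end Laws

/-! ## §3 At the LIVE selector of record (the K0 witnesses' selector) — ONE rewrite along dag-n19-c's tower identity `classWeightOfDatum₉_ppSelLive_eq_ppSelId` -/

section LiveSelector

variable (ϑ : Stage9Params F N) {p : B12.RunParams} {g : ℕ → ℝ} {g₀ : ℕ → ℝ}

/-- **★ E1 AT EVERY LEVEL AT THE LIVE SELECTOR** `ϑ.ppSel = ppSelLiveOfRecord … E (wOfRecord₉ ϑ)` (any normalisation `E`), for a run whose coupling history starts at the
dressing's coupling (`g 0 = g₀ K`), under the displayed laws: the dressed class weights at the live re-pin ARE the identity re-pin's (dag-n19-c), and §1 applies to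
`{ ϑ with ppSel := ppSelIdOfRecord }` (same `ν`, `τ9`, `A₁`, `ζ`, step weights). [cite: Balaban1989LargeFieldI, (0.3)–(0.4) p.176 and p.177; Balaban1985UV3, (6) p.257; King1986, (3.10) p.656] -/
theorem sum_classWeightOfDatum₉_eq_schemeZ_of_ppSelLive (E : B12.RunParams → ℝ)
    (hsel : ϑ.ppSel = ppSelLiveOfRecord F N ϑ.ν ϑ.τ9 E (wOfRecord₉ F N ϑ)) (hg : g 0 = g₀ p.K)
    (hw0 : ∀ k s' U V', 0 ≤ wOfRecord₉ F N ϑ p g k s' U V') (hw1 : ∀ k s' U V', wOfRecord₉ F N ϑ p g k s' U V' ≤ 1)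
    (hwm : ∀ k s', Measurable fun z : GaugeField (F.P p.K) (k + 1) (SU N) × GaugeField (F.P p.K) k (SU N) => wOfRecord₉ F N ϑ p g k s' z.2 z.1)
    (hχm : ∀ k s, Measurable (chiSeqOfRecord F N ϑ.ν ϑ.τ9.M g p.K k s)) (hζu : IsZetaUnity F N ϑ.ν ϑ.τ9.M ϑ.ζ)
    (D : FiniteEpsData F (SU N)) (hD : D.AvgMeasurable) (os : List (ULoop F)) (t : ℝ) (k : ℕ) (hk : k ≤ p.K) :
    ∑ s : SeqOfRecord F ϑ.ν ϑ.τ9.M g p.K k, classWeightOfDatum₉ F N ϑ D g₀ os p g k t s = T4GenFunBounds.schemeZ (D.scheme g₀) os p.K t := by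
  rw [Finset.sum_congr rfl fun s _ => classWeightOfDatum₉_ppSelLive_eq_ppSelId F N ϑ D g₀ os p g E hsel hg hD hw0 hwm hχm k t s]
  exact sum_classWeightOfDatum₉_eq_schemeZ_of_ppSelId { ϑ with ppSel := ppSelIdOfRecord F ϑ.ν ϑ.τ9.M } rfl hw0 hw1 hwm hχm hζu D hD g₀ os t k hk

/-- **E1 AT EVERY LEVEL AT THE LIVE SELECTOR, LAWS FROM THE ROWS** ((H-U), (H-ζ), `0 ≤ ζ`, `IsZetaAbsLeOne`, `IsZetaUnity`; `g 0 = g₀ K`).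
[cite: Balaban1989LargeFieldI, (0.3)–(0.4) p.176; Balaban1985UV3, (6) p.257; Balaban1988Convergent, (3.16) p.268 (bookkeeping)] -/
theorem sum_classWeightOfDatum₉_eq_schemeZ_of_ppSelLive_of_localBg (E : B12.RunParams → ℝ)
    (hsel : ϑ.ppSel = ppSelLiveOfRecord F N ϑ.ν ϑ.τ9 E (wOfRecord₉ F N ϑ)) (hg : g 0 = g₀ p.K)
    (hU : LocalBgMeasurable F N ϑ.ν) (hζm : ZetaMeasurable F N ϑ.ζ) (hζ0 : ∀ p g k s Pl Ql RS U V', 0 ≤ ϑ.ζ p g k s Pl Ql RS U V')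
    (hζ1 : IsZetaAbsLeOne F N ϑ.ν ϑ.τ9.M ϑ.ζ) (hζu : IsZetaUnity F N ϑ.ν ϑ.τ9.M ϑ.ζ)
    (D : FiniteEpsData F (SU N)) (hD : D.AvgMeasurable) (os : List (ULoop F)) (t : ℝ) (k : ℕ) (hk : k ≤ p.K) :
    ∑ s : SeqOfRecord F ϑ.ν ϑ.τ9.M g p.K k, classWeightOfDatum₉ F N ϑ D g₀ os p g k t s = T4GenFunBounds.schemeZ (D.scheme g₀) os p.K t :=
  sum_classWeightOfDatum₉_eq_schemeZ_of_ppSelLive ϑ E hsel hg (wOfRecord₉_nonneg ϑ hζ0 p g) (wOfRecord₉_le_one ϑ hζ1 p g)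
    (fun k s' => measurable_wOfRecord_of_localBg hU ϑ.τ9.M ϑ.A₁ hζm p g k s')
    (fun k s => measurable_chiSeqOfRecord_of_localBg hU ϑ.τ9.M g p.K k s) hζu D hD os t k hk

end LiveSelector

/-! ## §4 ★ At the K0‴ witness family `θ₁₃ = theta13LiveOfFamily F N ε₀ (zeta316OfRecord …) Rz Zt` (Record 13's witness of record is its member; the v1.5∕v1.6∕v1.7
editions' witnesses carry the same Stage-9 part): ζ-laws by K0b, selector by `theta13LiveOfFamily_ppSel` — ONE displayed hypothesis left, (H-U) at the family's numerics -/

section Witness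

/-- **★★ E1 AT EVERY LEVEL AT THE STAGE-13 WITNESS FAMILY** `θ₁₃ = theta13LiveOfFamily F N ε₀ (zeta316OfRecord F N (numerics7OfFamily ε₀) 1 1) Rz Zt`: for a run whose
coupling history starts at the dressing's coupling (`g 0 = g₀ K`) and a datum with measurable averaging, `Σ_s classWeightOfDatum₉ θ₁₃.toStage9Params D g₀ os p g k t s =
schemeZ (D.scheme g₀) os K t` for every `k ≤ K` — ζ-laws DISCHARGED by K0b (`zeta316OfRecord_nonneg`, `isZetaAbsLeOne_zeta316OfRecord`, `isZetaUnity_zeta316OfRecord`,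
`zetaMeasurable_zeta316OfRecord_of_localBg`), the live selector by `theta13LiveOfFamily_ppSel`; ONE displayed hypothesis: (H-U) `LocalBgMeasurable` at `numerics7OfFamily ε₀`.
[cite: Balaban1985UV3, (6) p.257; King1986, (3.10) p.656; Balaban1989LargeFieldI, (0.3)–(0.4) p.176; Balaban1988Convergent, (3.16) p.268, (3.20)–(3.21) p.269] -/
theorem sum_classWeightOfDatum₉_eq_schemeZ_theta13LiveOfFamily (ε₀ : ℝ) (hU : LocalBgMeasurable F N (numerics7OfFamily ε₀))
    (Rz : (K : ℕ) → Sect2.Residual (F.P K) (MatA N)) (Zt : (K : ℕ) → TkResidualW F N (FluctV N) K)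
    (D : FiniteEpsData F (SU N)) (hD : D.AvgMeasurable) (g₀ : ℕ → ℝ) (os : List (ULoop F)) (p : B12.RunParams) (g : ℕ → ℝ) (hg : g 0 = g₀ p.K)
    (t : ℝ) (k : ℕ) (hk : k ≤ p.K) :
    ∑ s : SeqOfRecord F (numerics7OfFamily ε₀) 1 g p.K k,
        classWeightOfDatum₉ F N (theta13LiveOfFamily F N ε₀ (zeta316OfRecord F N (numerics7OfFamily ε₀) 1 1) Rz Zt).toStage9Params D g₀ os p g k t s
      = T4GenFunBounds.schemeZ (D.scheme g₀) os p.K t :=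
  sum_classWeightOfDatum₉_eq_schemeZ_of_ppSelLive_of_localBg _ _ (theta13LiveOfFamily_ppSel F N ε₀ _ Rz Zt) hg hU
    (zetaMeasurable_zeta316OfRecord_of_localBg hU 1 1) (zeta316OfRecord_nonneg 1) (isZetaAbsLeOne_zeta316OfRecord (A₁ := 1))
    (isZetaUnity_zeta316OfRecord (A₁ := 1)) D hD os t k hk

end Witness

/-! ## §5 (v1.1, APPEND-ONLY) THE E2 SHAPE: class weights summed FIBREWISE along any truncation map still give the scheme's dressed partition function — the
run-B half `schemeZ … (K₀+K+1) t = Σ_{τ ∈ T K} B K t τ` of a two-run spine reading whose `B K t τ` is the fibre sum of run B's class weights over the run-A class `τ`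
(node U5d's truncation `SeqOfRecord` (cutoff `K+1`, length `k+1`) → classes of cutoff `K`) is this identity at run B's tuple -/

section Fiberwise

variable (ϑ : Stage9Params F N) {p : B12.RunParams} {g : ℕ → ℝ} {g₀ : ℕ → ℝ}

/-- **E1 AT EVERY LEVEL, SUMMED FIBREWISE** (identity selector; displayed laws): for any truncation map `tr` of the sequences of record into a finite index set `T` of
classes, `Σ_{τ ∈ T} Σ_{s : tr s = τ} classWeightOfDatum₉ ϑ D g₀ os p g k t s = schemeZ (D.scheme g₀) os K t` (`k ≤ K`) — `Finset.sum_fiberwise_of_maps_to` over ★★ §1.  This is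
the ANALYTIC CONTENT of the run-B extraction identity E2 of a two-run reading; the truncation map itself (node U5d) is Summits-side packaging, not built here.
[cite: Balaban1985UV3, (6) p.257; King1986, (3.10) p.656; Balaban1988Convergent, (2.18) p.257 (bookkeeping)] -/
theorem sum_fiberwise_classWeightOfDatum₉_eq_schemeZ_of_ppSelId {ι : Type*} [DecidableEq ι] (hsel : ϑ.ppSel = ppSelIdOfRecord F ϑ.ν ϑ.τ9.M)
    (hw0 : ∀ k s' U V', 0 ≤ wOfRecord₉ F N ϑ p g k s' U V') (hw1 : ∀ k s' U V', wOfRecord₉ F N ϑ p g k s' U V' ≤ 1)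
    (hwm : ∀ k s', Measurable fun z : GaugeField (F.P p.K) (k + 1) (SU N) × GaugeField (F.P p.K) k (SU N) => wOfRecord₉ F N ϑ p g k s' z.2 z.1)
    (hχm : ∀ k s, Measurable (chiSeqOfRecord F N ϑ.ν ϑ.τ9.M g p.K k s)) (hζu : IsZetaUnity F N ϑ.ν ϑ.τ9.M ϑ.ζ)
    (D : FiniteEpsData F (SU N)) (hD : D.AvgMeasurable) (g₀ : ℕ → ℝ) (os : List (ULoop F)) (t : ℝ) (k : ℕ) (hk : k ≤ p.K)
    (T : Finset ι) (tr : SeqOfRecord F ϑ.ν ϑ.τ9.M g p.K k → ι) (htr : ∀ s, tr s ∈ T) :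
    ∑ τ ∈ T, ∑ s ∈ Finset.univ.filter (fun s : SeqOfRecord F ϑ.ν ϑ.τ9.M g p.K k => tr s = τ), classWeightOfDatum₉ F N ϑ D g₀ os p g k t s
      = T4GenFunBounds.schemeZ (D.scheme g₀) os p.K t := by
  rw [Finset.sum_fiberwise_of_maps_to (s := Finset.univ) (t := T) (g := tr) (fun s _ => htr s)]
  exact sum_classWeightOfDatum₉_eq_schemeZ_of_ppSelId ϑ hsel hw0 hw1 hwm hχm hζu D hD g₀ os t k hk

/-- **E1 AT EVERY LEVEL, SUMMED FIBREWISE, AT THE LIVE SELECTOR** (`g 0 = g₀ K`; displayed laws). [cite: Balaban1989LargeFieldI, (0.3)–(0.4) p.176; King1986, (3.10) p.656 (bookkeeping)] -/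
theorem sum_fiberwise_classWeightOfDatum₉_eq_schemeZ_of_ppSelLive {ι : Type*} [DecidableEq ι] (E : B12.RunParams → ℝ)
    (hsel : ϑ.ppSel = ppSelLiveOfRecord F N ϑ.ν ϑ.τ9 E (wOfRecord₉ F N ϑ)) (hg : g 0 = g₀ p.K)
    (hw0 : ∀ k s' U V', 0 ≤ wOfRecord₉ F N ϑ p g k s' U V') (hw1 : ∀ k s' U V', wOfRecord₉ F N ϑ p g k s' U V' ≤ 1)
    (hwm : ∀ k s', Measurable fun z : GaugeField (F.P p.K) (k + 1) (SU N) × GaugeField (F.P p.K) k (SU N) => wOfRecord₉ F N ϑ p g k s' z.2 z.1)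
    (hχm : ∀ k s, Measurable (chiSeqOfRecord F N ϑ.ν ϑ.τ9.M g p.K k s)) (hζu : IsZetaUnity F N ϑ.ν ϑ.τ9.M ϑ.ζ)
    (D : FiniteEpsData F (SU N)) (hD : D.AvgMeasurable) (os : List (ULoop F)) (t : ℝ) (k : ℕ) (hk : k ≤ p.K)
    (T : Finset ι) (tr : SeqOfRecord F ϑ.ν ϑ.τ9.M g p.K k → ι) (htr : ∀ s, tr s ∈ T) :
    ∑ τ ∈ T, ∑ s ∈ Finset.univ.filter (fun s : SeqOfRecord F ϑ.ν ϑ.τ9.M g p.K k => tr s = τ), classWeightOfDatum₉ F N ϑ D g₀ os p g k t s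
      = T4GenFunBounds.schemeZ (D.scheme g₀) os p.K t := by
  rw [Finset.sum_fiberwise_of_maps_to (s := Finset.univ) (t := T) (g := tr) (fun s _ => htr s)]
  exact sum_classWeightOfDatum₉_eq_schemeZ_of_ppSelLive ϑ E hsel hg hw0 hw1 hwm hχm hζu D hD os t k hk

end Fiberwise

/-! ## §6 (v1.1, APPEND-ONLY) AT NODE 00's v1.7 RECORD `datumOfRecord₁₃CoPH F N θ h` (def-T FILE 27 `Node00/Record13CoPH.lean` p537939; FINDING №9, director-ym №183∕№186∕№190):
the ζ-rows `zetaAbs` ∕ `zetaUnity` and the averaging law `isPrintedAveraged_datumOfRecord₁₃CoPH` of the record consumed BY NAME; the dressed family is run at the record's own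
Stage-9 part `θ.toStage9Params` and started at the record's own datum -/

section AtRecordCoPH

/-- **E1 AT EVERY LEVEL AT THE v1.7 STAGE-13 RECORD** (`θ : Stage13HParams`, `h : θ.Provisos₁₃CoPH F N`), for a tuple pinned at the LIVE selector of record and a run with
`g 0 = g₀ K`: `Σ_s classWeightOfDatum₉ θ.toStage9Params (datumOfRecord₁₃CoPH F N θ h) g₀ os p g k t s = schemeZ ((datumOfRecord₁₃CoPH F N θ h).scheme g₀) os K t` for every
`k ≤ K` — rows `h.zetaAbs` ∕ `h.zetaUnity` and B1 `isPrintedAveraged_datumOfRecord₁₃CoPH` BY NAME; displayed: the selector pin, `0 ≤ ζ`, (H-U) `LocalBgMeasurable θ.ν`,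
(H-ζ) `ZetaMeasurable θ.ζ` (K0⁷'s rows ∕ residuals). [cite: Balaban1985UV3, (6) p.257; King1986, (3.10) p.656; Balaban1988Convergent, (3.16) p.268, (3.20)–(3.21) p.269; Balaban1989LargeFieldI, (0.3)–(0.4) p.176] -/
theorem sum_classWeightOfDatum₉_datumOfRecord₁₃CoPH_eq_schemeZ_of_ppSelLive (θ : Stage13HParams F N) (h : θ.Provisos₁₃CoPH F N)
    (E : B12.RunParams → ℝ) (hsel : θ.ppSel = ppSelLiveOfRecord F N θ.ν θ.τ9 E (wOfRecord₉ F N θ.toStage9Params))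
    (hU : LocalBgMeasurable F N θ.ν) (hζm : ZetaMeasurable F N θ.ζ) (hζ0 : ∀ p g k s Pl Ql RS U V', 0 ≤ θ.ζ p g k s Pl Ql RS U V')
    (g₀ : ℕ → ℝ) (os : List (ULoop F)) {p : B12.RunParams} {g : ℕ → ℝ} (hg : g 0 = g₀ p.K) (t : ℝ) (k : ℕ) (hk : k ≤ p.K) :
    ∑ s : SeqOfRecord F θ.ν θ.τ9.M g p.K k,
        classWeightOfDatum₉ F N θ.toStage9Params (datumOfRecord₁₃CoPH F N θ h) g₀ os p g k t s
      = T4GenFunBounds.schemeZ ((datumOfRecord₁₃CoPH F N θ h).scheme g₀) os p.K t :=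
  sum_classWeightOfDatum₉_eq_schemeZ_of_ppSelLive_of_localBg θ.toStage9Params E hsel hg hU hζm hζ0 h.zetaAbs h.zetaUnity
    (datumOfRecord₁₃CoPH F N θ h) (isPrintedAveraged_datumOfRecord₁₃CoPH F N θ h).avgMeasurable os t k hk

end AtRecordCoPH

end Summit.QuantumFields.YangMills.BalabanUVNodes.N19MGFFormAtRecordMass

end
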